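import Mathlib.Analysis.SpecialFunctions.Pow.Asymptotics
import Mathlib.Analysis.SpecialFunctions.Pow.Real
import Literature.MathematicalPhysics.QuantumLattice.HubbardHubbardModel
import HarnessLib

/-!
# Discharges for the Hubbard target statements (`HubbardHubbardModel`): Koma–Tasaki, no LRO

Family `hubbard` (trunk T-QLATTICE), statement hubbard.S11. Sibling proof file of
`Literature/MathematicalPhysics/QuantumLattice/HubbardHubbardModel.lean`: it proves consequences
of the named facts (`def X : Prop`, D-0014) of that file from Mathlib and the accepted prelude.
No statement is introduced or changed here.

Proved here:

* `Literature.MathematicalPhysics.QuantumLattice.not_hasTorusLRO_of_abs_le_rpow` — the elementary summation lemma behind every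
  "power-law decay ⇒ no long-range order" remark: if a family of torus two-point functions obeys
  `|G_L(x, y)| ≤ C (dist(x, y) + 1)^{-f}` with `f > 0` uniformly in the side `L ≥ 1`
  (`torusDist`, the periodic sup-distance of `LatticeTori`), then in every dimension `d ≥ 1`
  the normalised double sums `L^{-2d} Σ_{x, y} G_L(x, y)` tend to `0`, so `¬ HasTorusLRO G`
  (the outline-§0 convention `liminf_L L^{-2d} Σ_{x, y} G_L(x, y) > 0`, Friedli–Velenik 2017,
  Definition 3.27). Auxiliary: `card_filter_torusDist_le` (a ball of radius `R` of the torus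
  metric has at most `(2R + 1)^d` sites), `sum_rpow_torusDist_le`
  (`Σ_y (dist(x, y) + 1)^{-f} ≤ (2R + 1)^d + L^d (R + 1)^{-f}` for every cut-off `R`),
  `sum_abs_le_of_abs_le_rpow`, `sum_halfOpenBox_torusPullback` (the double sum over the
  fundamental domain `halfOpenBox d L ⊆ ℤ^d` is the double sum over `(ℤ/Lℤ)^d`).
* `Literature.MathematicalPhysics.QuantumLattice.not_hasTorusLRO_thermalPairCorr`, `Literature.MathematicalPhysics.QuantumLattice.not_hasTorusLRO_thermalSpinCorr` —
  the two conjuncts of `koma_tasaki_noLRO` from the corresponding uniform power-law bounds.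
* `Literature.Hubbard.koma_tasaki_noLRO_of : koma_tasaki_2d → koma_tasaki_magnetic → koma_tasaki_noLRO`
  — the reduction of the named fact `koma_tasaki_noLRO` (no superconducting or magnetic
  long-range order at `T > 0` in the two-dimensional Hubbard model) to the two named facts
  transcribing the Koma–Tasaki theorem itself (only the `d = 2` half of `koma_tasaki_magnetic`
  is used). The unconditional `koma_tasaki_noLRO_holds` awaits the discharge of those two facts
  (the McBryan–Spencer complex-rotation argument of the source, eqs. (5)–(12)).

## Source

T. Koma, H. Tasaki, *Decay of superconducting and magnetic correlations in one- and
two-dimensional Hubbard models*, Phys. Rev. Lett. **68** (1992) 3248–3251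
= arXiv:cond-mat/9709068 (held copy, 5 pp.). Theorem (arXiv p. 2): in `d = 2`,
`|⟨c†_{x↑} c†_{x↓} c_{y↓} c_{y↑} + h.c.⟩| ≤ 2 |x - y|^{-α f(β)}` (eq. (2)) and
`|⟨S_x^{(1)} S_y^{(1)} + S_x^{(2)} S_y^{(2)}⟩| ≤ |x - y|^{-α f(β)}` (eq. (3)) for `|x - y|` large,
with `f(β) > 0` (eq. (4)); the state is the limit of the torus Gibbs states, and the printed
proof bounds the finite-volume expectations `⟨A⟩_L` uniformly (eq. (12)). The "corollary" is
the sentence following the theorem (arXiv p. 3): "The above bounds rigorously rule out the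
possibility of the corresponding condensations of electrons or electron pairs and of the
corresponding magnetic ordering." The vendored `koma_tasaki_noLRO` reads "rule out ... ordering"
in the outline-§0 sense `¬ HasTorusLRO`; the present file supplies exactly the printed
implication "bounds ⇒ no order", i.e. the `o(L^{2d})` summation of a uniform power law.

## Proof sketch (`not_hasTorusLRO_of_abs_le_rpow`)

Fix `R`. For `x` on the torus, split `y` according to `dist(x, y) ≤ R` or `> R`:
`(dist + 1)^{-f} ≤ 𝟙[dist ≤ R] + (R + 1)^{-f}` pointwise, and
`#{y | dist(x, y) ≤ R} ≤ (2R + 1)^d` (inject `y ↦ (val (x - y)_i)_i` into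
`Πᵢ ({0..R} ∪ [L - R, L))`), whence `Σ_y |G_L(x, y)| ≤ C⁺ ((2R + 1)^d + L^d (R + 1)^{-f})`,
`C⁺ = max(C, 0)`. Summing over the `L^d` values of `x` (the double sum over `halfOpenBox d L`
is the torus double sum by `torusProj_bijOn_halfOpenBox`) and dividing by `L^{2d}`:
`|a_L| ≤ C⁺ (2R + 1)^d / L^d + C⁺ (R + 1)^{-f}`. Given `ε > 0` choose `R` with
`C⁺ (R + 1)^{-f} < ε/2` (`tendsto_rpow_neg_atTop`), then `L` with `C⁺ (2R + 1)^d / L^d < ε/2`;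
so `a_L → 0`, `liminf_L a_L = 0`, and `0 < liminf` fails.
-/

noncomputable section

open Filter Finset Topology

namespace Literature.MathematicalPhysics.QuantumLattice

open Literature.Probability.LatticeModels

variable {d : ℕ}

/-- On the torus `(ℤ/Lℤ)^d` (`L ≥ 1`), the ball of radius `R` of the periodic sup-distance
`torusDist` around any site has at most `(2R + 1)^d` sites (with equality for `2R + 1 ≤ L`).
(Friedli–Velenik 2017, §3.1, periodic boundary conditions.) [folklore] -/
theorem card_filter_torusDist_le (L : ℕ) [NeZero L] (x : TorusSite d L) (R : ℕ) :
    #{y : TorusSite d L | torusDist x y ≤ R} ≤ (2 * R + 1) ^ d := by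
  classical
  calc #{y : TorusSite d L | torusDist x y ≤ R}
      ≤ #(Fintype.piFinset fun _ : Fin d => Finset.range (R + 1) ∪ Finset.Ico (L - R) L) := by
        refine Finset.card_le_card_of_injOn (fun y i => ((x - y) i).val) ?_ ?_
        · intro y hy
          simp only [coe_filter, mem_univ, true_and, Set.mem_setOf_eq] at hy
          simp only [mem_coe, Fintype.mem_piFinset, mem_union, mem_range, mem_Ico]
          intro i
          have hi : min ((x - y) i).val (L - ((x - y) i).val) ≤ R := by
            have := (Finset.sup_le_iff.1 (show torusNorm (x - y) ≤ R from hy)) i (mem_univ i)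
            simpa using this
          have hlt : ((x - y) i).val < L := ZMod.val_lt _
          rcases min_le_iff.1 hi with h | h
          · left; omega
          · right; omega
        · intro y₁ _ y₂ _ h
          have key : x - y₁ = x - y₂ := by
            funext i
            exact ZMod.val_injective L (congrFun h i)
          exact sub_right_injective key
    _ = (#(Finset.range (R + 1) ∪ Finset.Ico (L - R) L)) ^ d := by
        rw [Fintype.card_piFinset_const]
    _ ≤ (2 * R + 1) ^ d := by
        gcongr
        calc #(Finset.range (R + 1) ∪ Finset.Ico (L - R) L)
            ≤ #(Finset.range (R + 1)) + #(Finset.Ico (L - R) L) := card_union_le _ _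
          _ ≤ 2 * R + 1 := by simp only [card_range, Nat.card_Ico]; omega

/-- The row sums of the power-law kernel on the torus `(ℤ/Lℤ)^d`: for every cut-off radius `R`
and every exponent `f ≥ 0`, `Σ_y (dist(x, y) + 1)^{-f} ≤ (2R + 1)^d + L^d (R + 1)^{-f}`
(the `y` with `dist ≤ R` contribute at most `1` each, the others at most `(R + 1)^{-f}` each).
(Friedli–Velenik 2017, §3.7.2.) [folklore] -/
theorem sum_rpow_torusDist_le (L : ℕ) [NeZero L] (x : TorusSite d L) {f : ℝ} (hf : 0 ≤ f)
    (R : ℕ) :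
    ∑ y : TorusSite d L, ((torusDist x y : ℝ) + 1) ^ (-f) ≤
      (2 * R + 1 : ℝ) ^ d + (L : ℝ) ^ d * ((R : ℝ) + 1) ^ (-f) := by
  classical
  have hpt : ∀ y : TorusSite d L, ((torusDist x y : ℝ) + 1) ^ (-f) ≤
      (if torusDist x y ≤ R then (1 : ℝ) else 0) + ((R : ℝ) + 1) ^ (-f) := by
    intro y
    have h0 : 0 ≤ ((R : ℝ) + 1) ^ (-f) := Real.rpow_nonneg (by positivity) _
    split_ifs with hR
    · have h1 : ((torusDist x y : ℝ) + 1) ^ (-f) ≤ 1 :=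
        Real.rpow_le_one_of_one_le_of_nonpos (by simp) (by linarith)
      linarith
    · rw [zero_add]
      refine Real.rpow_le_rpow_of_nonpos (by positivity) ?_ (by linarith)
      have : (R : ℝ) + 1 ≤ (torusDist x y : ℝ) := by exact_mod_cast Nat.lt_of_not_le hR
      linarith
  calc ∑ y : TorusSite d L, ((torusDist x y : ℝ) + 1) ^ (-f)
      ≤ ∑ y : TorusSite d L,
          ((if torusDist x y ≤ R then (1 : ℝ) else 0) + ((R : ℝ) + 1) ^ (-f)) :=
        Finset.sum_le_sum fun y _ => hpt y
    _ = (#{y : TorusSite d L | torusDist x y ≤ R} : ℝ) + (L : ℝ) ^ d * ((R : ℝ) + 1) ^ (-f) := by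
        rw [Finset.sum_add_distrib, Finset.sum_boole, Finset.sum_const, nsmul_eq_mul,
          Finset.card_univ, Fintype.card_pi]
        simp [ZMod.card, Finset.prod_const]
    _ ≤ (2 * R + 1 : ℝ) ^ d + (L : ℝ) ^ d * ((R : ℝ) + 1) ^ (-f) := by
        gcongr
        exact_mod_cast card_filter_torusDist_le L x R

/-- Row sums of a torus kernel dominated by a power law: if `|g(x, y)| ≤ C (dist(x, y) + 1)^{-f}`
(`f ≥ 0`), then `Σ_y |g(x, y)| ≤ max(C, 0) ((2R + 1)^d + L^d (R + 1)^{-f})` for every `R`.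
(Friedli–Velenik 2017, §3.7.2.) [folklore] -/
theorem sum_abs_le_of_abs_le_rpow {L : ℕ} [NeZero L] {g : TorusSite d L → TorusSite d L → ℝ}
    {C f : ℝ} (hf : 0 ≤ f)
    (hg : ∀ x y, |g x y| ≤ C * ((torusDist x y : ℝ) + 1) ^ (-f)) (x : TorusSite d L) (R : ℕ) :
    ∑ y, |g x y| ≤ max C 0 * ((2 * R + 1 : ℝ) ^ d + (L : ℝ) ^ d * ((R : ℝ) + 1) ^ (-f)) := by
  calc ∑ y, |g x y| ≤ ∑ y, max C 0 * ((torusDist x y : ℝ) + 1) ^ (-f) := by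
        refine Finset.sum_le_sum fun y _ => (hg x y).trans ?_
        exact mul_le_mul_of_nonneg_right (le_max_left _ _) (Real.rpow_nonneg (by positivity) _)
    _ = max C 0 * ∑ y, ((torusDist x y : ℝ) + 1) ^ (-f) := (Finset.mul_sum _ _ _).symm
    _ ≤ max C 0 * ((2 * R + 1 : ℝ) ^ d + (L : ℝ) ^ d * ((R : ℝ) + 1) ^ (-f)) :=
        mul_le_mul_of_nonneg_left (sum_rpow_torusDist_le L x hf R) (le_max_right _ _)

/-- For `L ≥ 1` the inner sum of `torusPullback G L` over the fundamental domain
`halfOpenBox d L = {0, …, L-1}^d` is the sum of `G L` over the torus `(ℤ/Lℤ)^d`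
(`Torus.proj L` is a bijection there, `torusProj_bijOn_halfOpenBox`).
(Friedli–Velenik 2017, §3.1.) [folklore] -/
theorem HubbardHubbardModelProofs.sum_halfOpenBox_torusPullback (G : (L : ℕ) → TorusSite d L → TorusSite d L → ℝ)
    (L : ℕ) [NeZero L] (x : Site d) :
    ∑ y ∈ halfOpenBox d L, torusPullback G L x y =
      ∑ y : TorusSite d L, G L (Torus.proj L x) y := by
  have hb := torusProj_bijOn_halfOpenBox (d := d) L
  exact Finset.sum_nbij (Torus.proj L) (fun _ _ => Finset.mem_univ _) hb.injOn
    (by simpa using hb.surjOn) (fun _ _ => rfl)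

/-- **Uniform power-law decay excludes long-range order on tori** (`d ≥ 1`). If a family of
torus two-point functions satisfies `|G_L(x, y)| ≤ C (dist(x, y) + 1)^{-f}` with `f > 0`,
uniformly in the side `L ≥ 1` (`torusDist`, the periodic sup-distance), then
`L^{-2d} Σ_{x, y ∈ (ℤ/Lℤ)^d} G_L(x, y) → 0`, hence `¬ HasTorusLRO G`: for every `R`,
`Σ_y (dist(x, y) + 1)^{-f} ≤ (2R + 1)^d + L^d (R + 1)^{-f}`, so the normalised double sum is
at most `max(C, 0) ((2R + 1)^d / L^d + (R + 1)^{-f})`, which is small for `R` and then `L`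
large. For `d = 0` the statement fails (one-point torus), whence `d ≠ 0`.
(Friedli–Velenik 2017, §3.7.2, Definition 3.27: long-range order versus decay of
correlations; Koma–Tasaki, PRL 68 (1992) 3248, remark after the Theorem.) [folklore] -/
theorem not_hasTorusLRO_of_abs_le_rpow (hd : d ≠ 0)
    {G : (L : ℕ) → TorusSite d L → TorusSite d L → ℝ} {C f : ℝ} (hf : 0 < f)
    (hG : ∀ (L : ℕ) [NeZero L] (x y : TorusSite d L),
      |G L x y| ≤ C * ((torusDist x y : ℝ) + 1) ^ (-f)) :
    ¬ HasTorusLRO G := by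
  classical
  -- the normalised double sums of the LRO convention
  set a : ℕ → ℝ := fun L =>
    (∑ x ∈ halfOpenBox d L, ∑ y ∈ halfOpenBox d L, torusPullback G L x y) /
      (#(halfOpenBox d L) : ℝ) ^ 2 with ha
  set C' : ℝ := max C 0 with hC'
  have hC'0 : 0 ≤ C' := le_max_right _ _
  -- the basic estimate, for every cut-off radius `R` and every side `L ≥ 1`
  have hest : ∀ (R L : ℕ), L ≠ 0 →
      |a L| ≤ C' * (2 * R + 1 : ℝ) ^ d / (L : ℝ) ^ d + C' * ((R : ℝ) + 1) ^ (-f) := by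
    intro R L hL
    haveI : NeZero L := ⟨hL⟩
    have hLpos : (0 : ℝ) < (L : ℝ) ^ d := by positivity
    set B : ℝ := (2 * R + 1 : ℝ) ^ d + (L : ℝ) ^ d * ((R : ℝ) + 1) ^ (-f) with hB
    have hrow : ∀ x ∈ halfOpenBox d L,
        |∑ y ∈ halfOpenBox d L, torusPullback G L x y| ≤ C' * B := by
      intro x _
      calc |∑ y ∈ halfOpenBox d L, torusPullback G L x y|
          ≤ ∑ y ∈ halfOpenBox d L, |torusPullback G L x y| := Finset.abs_sum_le_sum_abs _ _
        _ = ∑ y : TorusSite d L, |G L (Torus.proj L x) y| :=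
            HubbardHubbardModelProofs.sum_halfOpenBox_torusPullback (fun L x y => |G L x y|) L x
        _ ≤ C' * B := sum_abs_le_of_abs_le_rpow hf.le (fun x y => hG L x y) _ R
    have hS : |∑ x ∈ halfOpenBox d L, ∑ y ∈ halfOpenBox d L, torusPullback G L x y| ≤
        (L : ℝ) ^ d * (C' * B) := by
      calc |∑ x ∈ halfOpenBox d L, ∑ y ∈ halfOpenBox d L, torusPullback G L x y|
          ≤ ∑ x ∈ halfOpenBox d L, |∑ y ∈ halfOpenBox d L, torusPullback G L x y| :=
            Finset.abs_sum_le_sum_abs _ _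
        _ ≤ #(halfOpenBox d L) • (C' * B) := Finset.sum_le_card_nsmul _ _ _ hrow
        _ = (L : ℝ) ^ d * (C' * B) := by rw [nsmul_eq_mul, card_halfOpenBox]; push_cast; ring
    have hcard : (#(halfOpenBox d L) : ℝ) = (L : ℝ) ^ d := by
      rw [card_halfOpenBox]; push_cast; ring
    rw [ha]
    dsimp only
    rw [hcard, abs_div, abs_of_nonneg (by positivity : (0 : ℝ) ≤ ((L : ℝ) ^ d) ^ 2),
      div_le_iff₀ (by positivity)]
    calc |∑ x ∈ halfOpenBox d L, ∑ y ∈ halfOpenBox d L, torusPullback G L x y|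
        ≤ (L : ℝ) ^ d * (C' * B) := hS
      _ = (C' * (2 * R + 1 : ℝ) ^ d / (L : ℝ) ^ d + C' * ((R : ℝ) + 1) ^ (-f)) *
            ((L : ℝ) ^ d) ^ 2 := by
          rw [hB]; field_simp
  -- hence `a L → 0`
  have hT : Tendsto a atTop (𝓝 0) := by
    rw [Metric.tendsto_atTop]
    intro ε hε
    -- choose the cut-off radius `R` …
    have h1 : Tendsto (fun R : ℕ => C' * ((R : ℝ) + 1) ^ (-f)) atTop (𝓝 0) := by
      have := ((tendsto_rpow_neg_atTop hf).comp
        (tendsto_atTop_add_const_right atTop (1 : ℝ) tendsto_natCast_atTop_atTop)).const_mul C'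
      simpa using this
    obtain ⟨R, hR⟩ := (h1.eventually (eventually_lt_nhds (half_pos hε))).exists
    -- … then the side `L`
    have h2 : Tendsto (fun L : ℕ => C' * (2 * R + 1 : ℝ) ^ d / (L : ℝ) ^ d) atTop (𝓝 0) :=
      tendsto_const_nhds.div_atTop ((tendsto_pow_atTop hd).comp tendsto_natCast_atTop_atTop)
    obtain ⟨N, hN⟩ := eventually_atTop.1 (h2.eventually (eventually_lt_nhds (half_pos hε)))
    refine ⟨max N 1, fun L hL => ?_⟩
    have hLN : N ≤ L := le_of_max_le_left hL
    have hL1 : L ≠ 0 := by have := le_of_max_le_right hL; omega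
    rw [Real.dist_0_eq_abs]
    calc |a L| ≤ C' * (2 * R + 1 : ℝ) ^ d / (L : ℝ) ^ d + C' * ((R : ℝ) + 1) ^ (-f) :=
          hest R L hL1
      _ < ε / 2 + ε / 2 := add_lt_add (hN L hLN) hR
      _ = ε := add_halves ε
  intro hLRO
  change 0 < liminf a atTop at hLRO
  rw [hT.liminf_eq] at hLRO
  exact lt_irrefl 0 hLRO

end Literature.MathematicalPhysics.QuantumLattice

namespace Literature.MathematicalPhysics.QuantumLattice

open Matrix Literature.Probability.LatticeModels HubbardHubbardModelProofs
open scoped ComplexOrder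

/-- No superconducting long-range order from the Koma–Tasaki pair bound: if, for fixed
`t, U, μ, β`, the thermal pair correlation of the Hubbard model on the tori `(ℤ/Lℤ)²` obeys
`|⟨c†_{x↑} c†_{x↓} c_{y↓} c_{y↑}⟩_{β, L}| ≤ C (dist(x, y) + 1)^{-f}` with `f > 0` uniformly in
`L`, then `¬ HasTorusLRO (thermalPairCorr β t U μ)` (its real part is dominated by the norm,
and `not_hasTorusLRO_of_abs_le_rpow`). Koma–Tasaki, PRL 68 (1992) 3248, Theorem, eq. (2), and
the remark following it ("the above bounds rigorously rule out the possibility of the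
corresponding condensations ... of electron pairs"). [cite: KomaTasakiPRL1992, Theorem eq. (2) and remark after the Theorem] -/
theorem not_hasTorusLRO_thermalPairCorr {t U μ β f C : ℝ} (hf : 0 < f)
    (h : ∀ (L : ℕ) [NeZero L] (x y : TorusSite 2 L),
      ‖(hubbardTorusWith 2 L t U μ).thermalCorr β (onSitePair x)ᴴ (onSitePair y)‖ ≤
        C * ((torusDist x y : ℝ) + 1) ^ (-f)) :
    ¬ HasTorusLRO (thermalPairCorr (d := 2) β t U μ) := by
  refine not_hasTorusLRO_of_abs_le_rpow two_ne_zero (C := C) hf fun L _ x y => ?_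
  cases L with
  | zero => exact absurd rfl (NeZero.ne 0)
  | succ n => exact (Complex.abs_re_le_norm _).trans (h (n + 1) x y)

/-- No magnetic long-range order from the Koma–Tasaki spin bound: if, for fixed `t, U, μ, β`,
the thermal transverse spin correlation on the tori `(ℤ/Lℤ)²` obeys
`|⟨S⁺_x S⁻_y⟩_{β, L}| ≤ C (dist(x, y) + 1)^{-f}` with `f > 0` uniformly in `L`, then
`¬ HasTorusLRO (thermalSpinCorr β t U μ)`. Koma–Tasaki, PRL 68 (1992) 3248, Theorem, eq. (3),
and the remark following it ("... and of the corresponding magnetic ordering").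
[cite: KomaTasakiPRL1992, Theorem eq. (3) and remark after the Theorem] -/
theorem not_hasTorusLRO_thermalSpinCorr {t U μ β f C : ℝ} (hf : 0 < f)
    (h : ∀ (L : ℕ) [NeZero L] (x y : TorusSite 2 L),
      ‖(hubbardTorusWith 2 L t U μ).thermalCorr β (siteSpinPlus x) (siteSpinPlus y)ᴴ‖ ≤
        C * ((torusDist x y : ℝ) + 1) ^ (-f)) :
    ¬ HasTorusLRO (thermalSpinCorr (d := 2) β t U μ) := by
  refine not_hasTorusLRO_of_abs_le_rpow two_ne_zero (C := C) hf fun L _ x y => ?_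
  cases L with
  | zero => exact absurd rfl (NeZero.ne 0)
  | succ n => exact (Complex.abs_re_le_norm _).trans (h (n + 1) x y)

/-- Reduction of the hubbard.S11 corollary to the theorem: the named fact
`koma_tasaki_noLRO` (no superconducting or magnetic long-range order at `T > 0` in the
two-dimensional Hubbard model, outline-§0 convention `¬ HasTorusLRO`) follows from the named
facts `koma_tasaki_2d` (uniform power-law decay of the thermal pair correlation on `(ℤ/Lℤ)²`)
and `koma_tasaki_magnetic` (the same for `⟨S⁺_x S⁻_y⟩`; only its `d = 2` half is used), by the
summation lemma `not_hasTorusLRO_of_abs_le_rpow` (`Σ_y (dist(x, y) + 1)^{-f} = o(L²)`).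
This is the printed passage from the Theorem to "the above bounds rigorously rule out the
possibility of the corresponding condensations of electrons or electron pairs and of the
corresponding magnetic ordering". Koma–Tasaki, PRL 68 (1992) 3248, Theorem and the remark
following it (arXiv:cond-mat/9709068, p. 3). [cite: KomaTasakiPRL1992, Theorem and remark after the Theorem (arXiv p. 3)] -/
theorem koma_tasaki_noLRO_of (h2d : koma_tasaki_2d) (hmag : koma_tasaki_magnetic) :
    koma_tasaki_noLRO := by
  intro t U μ β hβ
  obtain ⟨f, hf, C, hC⟩ := h2d t U μ β hβ
  obtain ⟨⟨f', hf', C', hC'⟩, -⟩ := hmag t U μ β hβ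
  exact ⟨not_hasTorusLRO_thermalPairCorr hf (fun L _ x y => hC L x y),
    not_hasTorusLRO_thermalSpinCorr hf' (fun L _ x y => hC' L x y)⟩

end Literature.MathematicalPhysics.QuantumLattice
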